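/-
Copyright (c) 2026 the pub-hodgecm-mathlib formalisation cell (harness21).  Prover seat hodgecm-mathlib-K2Liu-p03 (g7): Track B «K2-LIT», hLiu418 = stmt-HodgeConjecture-24832,
road `K2_Liu`, #41 (β) Euler face, brick (E6) FILE 2 (LEAD BATCH #53 (1); K2Liu-p13 (g4) desk «=» 16:33:47Z): AWAY PURITY AS A FLAT FAMILY ON THE SLICE.
-/
import Summits.HodgeConjecture.HodgeConjecture.Theorems.K2LiuIwasawaHeightPlaceFactorisation        -- ★ (E6) FILE 1 `modDelta_pPart_placesEmbed`
import Summits.HodgeConjecture.HodgeConjecture.Theorems.K2LiuKFiniteSectionMultiPlaceArchContinuous -- ★ σ9 `exists_awayPurity_continuous` ((asm-3AB) + continuity)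
import Summits.HodgeConjecture.HodgeConjecture.Theorems.K2LiuStdExtensionDatumMonotone              -- ★ `stdExtension_apply_eq_of_flat`
import Summits.HodgeConjecture.HodgeConjecture.Theorems.K2LiuIncoherentPatternFamily                 -- ★ G2 §0 `exists_finset_forall_evalPlace_finPart_mem_localInt`
import Summits.HodgeConjecture.HodgeConjecture.Theorems.K2LiuIwasawaHeightContinuous                 -- ★ `continuous_iwasawaHeight`
import Literature.NumberTheory.Automorphic.MixedSpaceUnitsMellinProduct                           -- ★ `ofReal_prod_cpow` (`(∏ xᵢ)^r = ∏ xᵢ^r`, reused per dedup)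
import HarnessLib

/-!
# Crux `HLiu418`, road `K2_Liu`, #41 (β) Euler face, (E6) FILE 2: away purity of a standard family AS A FLAT FAMILY on the slice `H_∞ × ∏_{v∈T} H_v`

Cell `hodgecm-mathlib`, crux item hLiu418 = `stmt-HodgeConjecture-24832`; squad K2 ∕ K2Liu; prover K2Liu-p03 (g7).  THEOREMS ONLY (no `def`, no instance, no notation,
no named-fact hypothesis, no `sorry`); lane `--supports stmt-HodgeConjecture-24832 --as helper`.

(E6′) (K2Liu-p13 (g4)'s census `CENSUS-Beta-EulerFace` §1 (E6), desk «=» on the shape): for `𝒦` STANDARD, a `𝒦`-standard continuous family `f` for `χ` and ANY `s₀` there is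
`S₀` such that for every `T ⊇ S₀`: `(𝒦.K)_v ⊆ K_{H,v}` and `χ` unramified off `T`, and ★ (asm-3AB)'s pure tensors `A_i ⊗ ⊗_{v∈T} b_{i,v}` at `s₀` (with ALL their letters:
`b_{i,v} ∈ I_v(s₀,χ_v)`, `A_i` `K_∞`-finite, continuous, archimedean Siegel law) give, for EVERY `s`, on the slice
`f_s(placesEmbed_T(y_∞, y)) = Σ_i (H_∞(y_∞)^{2(s−s₀)} A_i(y_∞)) · ∏_{v∈T} (H_v(y_v)^{2(s−s₀)} b_{i,v}(y_v))` (**`exists_awayPurity_flat`**), `H_∞(a) := |det_Δ p_{(a,1)}|^{1∕2}`,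
`H_v(u) := |det_Δ p_{ι_v u}|^{1∕2}` — flatness ★ `stdExtension_apply_eq_of_flat` + ★ (E6) FILE 1 + ★ `lambdaLoc_one` on the slice.  THE PER-FACTOR LETTERS (§1–§2): the local
flat family `u ↦ H_v(u)^{2(s−s₀)} b(u)` lies in `I_v(s, χ_v)` for EVERY `s` (**`heightTwistLoc_mem_localDegPS`**: Siegel law from `H_v(pu) = |det_Δ ι_v p|^{1∕2} H_v(u)`, smoothness
from the OPEN subgroup `ι_v⁻¹(𝒦.K)`), `H_v` continuous; the arch flat family `a ↦ H_∞(a)^{2(s−s₀)} A(a)` keeps the archimedean Siegel law AT `s`, `K_∞`-finiteness and continuity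
(**`heightTwistArch_siegel ∕ _kfinite ∕ continuous_heightTwistArch`**); everything is ENTIRE in `s` (`differentiable_heightTwist`).
[Tan1999, §1]; [KudlaRallis1994, §1]; [HarrisKudlaSweet1996, §1 (1.15)–(1.17)]; [Liu2011, §2B p. 862]; [BorelJacquet1979, §4.1].
HONEST LABEL.  Count-neutral helper: `HC_CM` is proved only modulo the 7 printed citations (2 remaining named inputs: hLiu418 = `stmt-HodgeConjecture-24832`,
h413 = `stmt-HodgeConjecture-24833`) until rung 0 closes.
-/

set_option autoImplicit false
set_option linter.dupNamespace false -- the mandated namespace repeats `HodgeConjecture.HodgeConjecture`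

noncomputable section

open scoped Matrix RestrictedProduct
open Filter Topology Set NumberField IsDedekindDomain
open Literature.NumberTheory.Automorphic Literature.NumberTheory.Automorphic.UnitaryGroup Literature.NumberTheory.GaloisRepresentations
open Literature.NumberTheory.GelbartRogawski1991 Literature.NumberTheory.GelbartRogawski1991.GRConstruction
open Literature.NumberTheory.GelbartRogawski1991.UnitaryDualPair
open Literature.NumberTheory.K2Lit.SiegelDoubled Literature.NumberTheory.K2Lit.LocalSiegelDoubled Literature.NumberTheory.K2Lit.PlaceSplitting
open Summit.HodgeConjecture.HodgeConjecture.Cruxes.HLiu418.K2LiuStdFamilyFactorisable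
open Summit.HodgeConjecture.HodgeConjecture.Cruxes.HLiu418.K2LiuSiegelSectionRestrictedProduct
open Summit.HodgeConjecture.HodgeConjecture.Cruxes.HLiu418.K2LiuIwasawaDeltaUnimodular
open Summit.HodgeConjecture.HodgeConjecture.Cruxes.HLiu418.K2LiuSiegelBigCellSectionOfLocalPrelims
open Summit.HodgeConjecture.HodgeConjecture.Cruxes.HLiu418.K2LiuIwasawaHeightPlaceFactorisation
open Summit.HodgeConjecture.HodgeConjecture.Cruxes.HLiu418.K2LiuKFiniteSectionMultiPlaceArchContinuous
open Summit.HodgeConjecture.HodgeConjecture.Cruxes.HLiu418.K2LiuStdExtensionDatumMonotone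
open Summit.HodgeConjecture.HodgeConjecture.Cruxes.HLiu418.K2LiuIncoherentPatternFamily
open Summit.HodgeConjecture.HodgeConjecture.Cruxes.HLiu418.K2LiuIwasawaHeightContinuous

namespace Summit.HodgeConjecture.HodgeConjecture.Cruxes.HLiu418.K2LiuStdFamilyAwayPurityFlat

/-! ## §0 Scalars -/

/-- `s ↦ t^{2(s−s₀)}·c` is entire for `t > 0`. [folklore] -/
theorem differentiable_heightTwist {t : ℝ} (ht : 0 < t) (s₀ c : ℂ) : Differentiable ℂ fun s : ℂ => ((t : ℝ) : ℂ) ^ (2 * (s - s₀)) * c :=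
  ((((differentiable_id.sub_const s₀).const_mul (2 : ℂ)).const_cpow (Or.inl (Complex.ofReal_ne_zero.2 ht.ne')))).mul_const c

/-- the Siegel character shifts by the modulus `M(p) = |det_Δ p|_𝔸^{1∕2}`: `M(p)^{2(s−s₀)} · δ_{χ,s₀}(p) = δ_{χ,s}(p)`. [cite: Tan1999, §1 p. 166] -/
theorem modDelta_cpow_mul_siegelDeltaCharacter {L : Type} [Field L] [NumberField L] [IsCMField L] {N M n : ℕ} (e : Fin N × Fin M ≃ Fin n)
    (dV : Fin N → L) (hdV : ∀ i, IsCMField.complexConj L (dV i) = dV i) (dW : Fin M → L) (hdW : ∀ i, IsCMField.complexConj L (dW i) = dW i)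
    (χ : HeckeCharacter L) (s₀ s : ℂ) (p : HA L e dV hdV dW hdW) :
    ((modDelta L e dV hdV dW hdW p : ℝ) : ℂ) ^ (2 * (s - s₀)) * siegelDeltaCharacter L e dV hdV dW hdW χ s₀ p = siegelDeltaCharacter L e dV hdV dW hdW χ s p := by
  have hne : ((modDelta L e dV hdV dW hdW p : ℝ) : ℂ) ≠ 0 := Complex.ofReal_ne_zero.2 (modDelta_pos L e dV hdV dW hdW p).ne'
  unfold siegelDeltaCharacter
  have hexp : ((modDelta L e dV hdV dW hdW p : ℝ) : ℂ) ^ (2 * s + (n : ℂ)) = ((modDelta L e dV hdV dW hdW p : ℝ) : ℂ) ^ (2 * (s - s₀)) * ((modDelta L e dV hdV dW hdW p : ℝ) : ℂ) ^ (2 * s₀ + (n : ℂ)) := by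
    rw [← Complex.cpow_add _ _ hne]; ring_nf
  rw [hexp]; ring

variable (L : Type) [Field L] [NumberField L] [IsCMField L]
variable {N M n : ℕ} (e : Fin N × Fin M ≃ Fin n)
  (dV : Fin N → L) (hdV : ∀ i, IsCMField.complexConj L (dV i) = dV i) (hdV0 : ∀ i, dV i ≠ 0)
  (dW : Fin M → L) (hdW : ∀ i, IsCMField.complexConj L (dW i) = dW i) (hdW0 : ∀ i, dW i ≠ 0)

/-! ## §1 The local height `H_v(u) := |det_Δ p_{ι_v u}|^{1∕2}` and the local flat family `H_v^{2(s−s₀)}·b` -/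

section Local
variable (v : HeightOneSpectrum (𝓞 (Fp L)))

include hdV0 hdW0 in
/-- **left `P_Δ(L⁺_v)`-law**: `H_v(p u) = |det_Δ ι_v p|^{1∕2} · H_v(u)` (★ `modDelta_pPart_delta_mul`, unimodularity ★ `IwasawaDatum.modDelta_eq_one_of_mem`). [cite: Tan1999, §1] -/
theorem heightLoc_siegel_mul (𝒦 : IwasawaDatum L e dV hdV dW hdW) {p : UnitaryGroup.localPi L (IsCMField.complexConj L) (n + n) (hermD L e dV hdV dW hdW) v} (hp : p ∈ siegelDeltaLoc L e dV hdV dW hdW v) (u : UnitaryGroup.localPi L (IsCMField.complexConj L) (n + n) (hermD L e dV hdV dW hdW) v) :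
    modDelta L e dV hdV dW hdW (𝒦.pPart (locToAdelic L e dV hdV dW hdW v (p * u))) = modDelta L e dV hdV dW hdW (locToAdelic L e dV hdV dW hdW v p) * modDelta L e dV hdV dW hdW (𝒦.pPart (locToAdelic L e dV hdV dW hdW v u)) := by
  rw [map_mul]
  exact IwasawaDatum.modDelta_pPart_delta_mul (IwasawaDatum.modDelta_eq_one_of_mem L e dV hdV hdV0 dW hdW hdW0 𝒦) ((mem_siegelDeltaLoc_iff L e dV hdV dW hdW v p).1 hp) _

include hdV0 hdW0 in
/-- **right invariance under `ι_v⁻¹(𝒦.K)`**: `H_v(u k) = H_v(u)` when `ι_v k ∈ 𝒦.K` (★ `modDelta_pPart_mul_K`). [cite: Tan1999, §1] -/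
theorem heightLoc_mul_of_mem (𝒦 : IwasawaDatum L e dV hdV dW hdW) (u : UnitaryGroup.localPi L (IsCMField.complexConj L) (n + n) (hermD L e dV hdV dW hdW) v) {k : UnitaryGroup.localPi L (IsCMField.complexConj L) (n + n) (hermD L e dV hdV dW hdW) v} (hk : locToAdelic L e dV hdV dW hdW v k ∈ 𝒦.K) :
    modDelta L e dV hdV dW hdW (𝒦.pPart (locToAdelic L e dV hdV dW hdW v (u * k))) = modDelta L e dV hdV dW hdW (𝒦.pPart (locToAdelic L e dV hdV dW hdW v u)) := by
  rw [map_mul]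
  exact IwasawaDatum.modDelta_pPart_mul_K (IwasawaDatum.modDelta_eq_one_of_mem L e dV hdV hdV0 dW hdW hdW0 𝒦) _ hk

include hdV0 hdW0 in
/-- `H_v` is continuous (★ `continuous_iwasawaHeight` ∘ ★ `continuous_inclPlaceAdelic`). [cite: BorelJacquet1979, §4.1] -/
theorem continuous_heightLoc (𝒦 : IwasawaDatum L e dV hdV dW hdW) : Continuous fun u : UnitaryGroup.localPi L (IsCMField.complexConj L) (n + n) (hermD L e dV hdV dW hdW) v => modDelta L e dV hdV dW hdW (𝒦.pPart (locToAdelic L e dV hdV dW hdW v u)) := by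
  have hloc : Continuous (locToAdelic L e dV hdV dW hdW v) := UnitaryGroup.continuous_inclPlaceAdelic (Fp L) L (IsCMField.complexConj L) (n + n) (hermD L e dV hdV dW hdW) v
  exact (continuous_iwasawaHeight L e dV hdV hdV0 dW hdW hdW0 𝒦).comp hloc

/-- **`ι_v⁻¹(𝒦.K)` is open** for `𝒦` standard (`K ⊇ (1, C_f)`, `C_f` open; `ι_v u = (1, (ι_v u)_f)`). [cite: BorelJacquet1979, §4.1] [cite: Tan1999, §1] -/
theorem isOpen_coe_comap_locToAdelic {𝒦 : IwasawaDatum L e dV hdV dW hdW} (h𝒦 : 𝒦.IsStd) :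
    IsOpen (((𝒦.K).comap (locToAdelic L e dV hdV dW hdW v) : Subgroup (UnitaryGroup.localPi L (IsCMField.complexConj L) (n + n) (hermD L e dV hdV dW hdW) v)) : Set (UnitaryGroup.localPi L (IsCMField.complexConj L) (n + n) (hermD L e dV hdV dW hdW) v)) := by
  obtain ⟨Cfin, hCo, hCK, hKC⟩ := h𝒦.exists_fin
  have hset : (((𝒦.K).comap (locToAdelic L e dV hdV dW hdW v) : Subgroup (UnitaryGroup.localPi L (IsCMField.complexConj L) (n + n) (hermD L e dV hdV dW hdW) v)) : Set (UnitaryGroup.localPi L (IsCMField.complexConj L) (n + n) (hermD L e dV hdV dW hdW) v)) =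
      (fun u => UnitaryGroup.finPart (Fp L) L (IsCMField.complexConj L) (n + n) (hermD L e dV hdV dW hdW) (locToAdelic L e dV hdV dW hdW v u)) ⁻¹' (Cfin : Set (UnitaryGroup.finAdelic (Fp L) L (IsCMField.complexConj L) (n + n) (hermD L e dV hdV dW hdW))) := by
    ext u
    simp only [SetLike.mem_coe, Subgroup.mem_comap, Set.mem_preimage]
    refine ⟨fun hu => hKC _ hu, fun hu => ?_⟩
    have h1 : locToAdelic L e dV hdV dW hdW v u = finAdelicToAdelic (Fp L) L (IsCMField.complexConj L) (n + n) (hermD L e dV hdV dW hdW) (UnitaryGroup.finPart (Fp L) L (IsCMField.complexConj L) (n + n) (hermD L e dV hdV dW hdW) (locToAdelic L e dV hdV dW hdW v u)) := by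
      refine eq_of_archPart_eq_of_finPart_eq L e dV hdV dW hdW _ _ ?_ ?_
      · rw [archPart_locToAdelic, archPart_finAdelicToAdelic]
      · rw [finPart_finAdelicToAdelic]
    rw [h1]
    exact hCK _ hu
  rw [hset]
  exact hCo.preimage ((UnitaryGroup.continuous_finPart (Fp L) L (IsCMField.complexConj L) (n + n) (hermD L e dV hdV dW hdW)).comp
    (UnitaryGroup.continuous_inclPlaceAdelic (Fp L) L (IsCMField.complexConj L) (n + n) (hermD L e dV hdV dW hdW) v))

set_option maxHeartbeats 800000 in -- the statement's local doubled unitary telescope of ★ `localDegPS` (measured: `whnf` timeout at the default 200000; as ★ G3)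
include hdV0 hdW0 in
/-- **the local flat family keeps the Siegel law, AT `s`**: if `b ∈ I_v(s₀, χ_v)` then `u ↦ H_v(u)^{2(s−s₀)}·b(u)` satisfies `F(p u) = χ_v(det_Δ p)|det_Δ p|^{s+n∕2} F(u)`
(`heightLoc_siegel_mul` and the character shift `modDelta_cpow_mul_siegelDeltaCharacter`). [cite: HarrisKudlaSweet1996, §1 (1.15)–(1.17)] [cite: KudlaRallis1994, §1] -/
theorem heightTwistLoc_siegel (𝒦 : IwasawaDatum L e dV hdV dW hdW) {χ : HeckeCharacter L} {s₀ : ℂ} {b : UnitaryGroup.localPi L (IsCMField.complexConj L) (n + n) (hermD L e dV hdV dW hdW) v → ℂ}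
    (hb : b ∈ localDegPS (Fp L) L (IsCMField.complexConj L) (complexConj_imagUnit L) (imagUnit_ne_zero L) (imagUnit_mul_self L)
          v n (gramR_isSymm L e dV hdV dW hdW) (hermD_eq_map_gramD L e dV hdV dW hdW) (fun w => χ.localComponent w.1) s₀) (s : ℂ) :
    Literature.NumberTheory.K2Lit.LocalSiegelDoubled.IsLocalSiegelSection (Fp L) L (IsCMField.complexConj L) (complexConj_imagUnit L) (imagUnit_ne_zero L)
          (imagUnit_mul_self L) v n (gramR_isSymm L e dV hdV dW hdW) (hermD_eq_map_gramD L e dV hdV dW hdW) (fun w => χ.localComponent w.1) s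
      (fun u => ((modDelta L e dV hdV dW hdW (𝒦.pPart (locToAdelic L e dV hdV dW hdW v u)) : ℝ) : ℂ) ^ (2 * (s - s₀)) * b u) := by
  haveI : Algebra.IsQuadraticExtension (Fp L) L := IsCMField.isQuadraticExtension L
  intro p hp u
  have hp' : p ∈ siegelDeltaLoc L e dV hdV dW hdW v := (mem_siegelDeltaLoc_iff_local L e dV hdV dW hdW v p).2 hp
  have hlaw := hb.1 p hp u
  rw [← siegelCharLoc_eq_localSiegelCharacter_of_mem L e dV hdV dW hdW v χ s₀ hp'] at hlaw
  show ((modDelta L e dV hdV dW hdW (𝒦.pPart (locToAdelic L e dV hdV dW hdW v (p * u))) : ℝ) : ℂ) ^ (2 * (s - s₀)) * b (p * u) =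
    Literature.NumberTheory.K2Lit.LocalSiegelDoubled.localSiegelCharacter (Fp L) L (IsCMField.complexConj L) v n (fun w => χ.localComponent w.1) s p * (((modDelta L e dV hdV dW hdW (𝒦.pPart (locToAdelic L e dV hdV dW hdW v u)) : ℝ) : ℂ) ^ (2 * (s - s₀)) * b u)
  rw [← siegelCharLoc_eq_localSiegelCharacter_of_mem L e dV hdV dW hdW v χ s hp', hlaw, heightLoc_siegel_mul L e dV hdV hdV0 dW hdW hdW0 v 𝒦 hp' u, Complex.ofReal_mul,
    Complex.mul_cpow_ofReal_nonneg (modDelta_pos L e dV hdV dW hdW _).le (modDelta_pos L e dV hdV dW hdW _).le, siegelCharLoc_apply, siegelCharLoc_apply,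
    ← modDelta_cpow_mul_siegelDeltaCharacter e dV hdV dW hdW χ s₀ s (locToAdelic L e dV hdV dW hdW v p)]
  ring

set_option maxHeartbeats 800000 in -- as above (measured)
include hdV0 hdW0 in
/-- **the local flat family is smooth**: `u ↦ H_v(u)^r·b(u)` is right-invariant under the OPEN subgroup `U ∩ ι_v⁻¹(𝒦.K)` when `b` is right-`U`-invariant
(`heightLoc_mul_of_mem`, `isOpen_coe_comap_locToAdelic`). [cite: HarrisKudlaSweet1996, §1 (1.15)] [cite: BorelJacquet1979, §4.1] -/
theorem heightTwistLoc_smooth {𝒦 : IwasawaDatum L e dV hdV dW hdW} (h𝒦 : 𝒦.IsStd) {b : UnitaryGroup.localPi L (IsCMField.complexConj L) (n + n) (hermD L e dV hdV dW hdW) v → ℂ}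
    (hb : Literature.NumberTheory.K2Lit.LocalSiegelDoubled.IsSmooth (Fp L) L (IsCMField.complexConj L) v n b) (r : ℂ) :
    Literature.NumberTheory.K2Lit.LocalSiegelDoubled.IsSmooth (Fp L) L (IsCMField.complexConj L) v n (fun u => ((modDelta L e dV hdV dW hdW (𝒦.pPart (locToAdelic L e dV hdV dW hdW v u)) : ℝ) : ℂ) ^ r * b u) := by
  obtain ⟨U, hU⟩ := hb
  refine ⟨⟨(U : Subgroup (UnitaryGroup.localPi L (IsCMField.complexConj L) (n + n) (hermD L e dV hdV dW hdW) v)) ⊓ (𝒦.K).comap (locToAdelic L e dV hdV dW hdW v), U.isOpen.inter (isOpen_coe_comap_locToAdelic L e dV hdV dW hdW v h𝒦)⟩, fun h u hu => ?_⟩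
  obtain ⟨huU, huK⟩ := Subgroup.mem_inf.1 hu
  have h1 : b (h * u) = b h := hU h u huU
  have h2 := heightLoc_mul_of_mem L e dV hdV hdV0 dW hdW hdW0 v 𝒦 h (Subgroup.mem_comap.1 huK)
  beta_reduce
  rw [h1, h2]

include hdV0 hdW0 in
/-- **THE LOCAL FLAT FAMILY LIES IN `I_v(s, χ_v)` FOR EVERY `s`**: if `b ∈ I_v(s₀, χ_v)` (★ `localDegPS`: Siegel law + smooth) then `u ↦ H_v(u)^{2(s−s₀)}·b(u) ∈ I_v(s, χ_v)`
(`heightTwistLoc_siegel` + `heightTwistLoc_smooth`). [cite: HarrisKudlaSweet1996, §1 (1.15)–(1.17)] [cite: KudlaRallis1994, §1] -/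
theorem heightTwistLoc_mem_localDegPS {𝒦 : IwasawaDatum L e dV hdV dW hdW} (h𝒦 : 𝒦.IsStd) {χ : HeckeCharacter L} {s₀ : ℂ} {b : UnitaryGroup.localPi L (IsCMField.complexConj L) (n + n) (hermD L e dV hdV dW hdW) v → ℂ}
    (hb : b ∈ localDegPS (Fp L) L (IsCMField.complexConj L) (complexConj_imagUnit L) (imagUnit_ne_zero L) (imagUnit_mul_self L)
          v n (gramR_isSymm L e dV hdV dW hdW) (hermD_eq_map_gramD L e dV hdV dW hdW) (fun w => χ.localComponent w.1) s₀) (s : ℂ) :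
    (fun u => ((modDelta L e dV hdV dW hdW (𝒦.pPart (locToAdelic L e dV hdV dW hdW v u)) : ℝ) : ℂ) ^ (2 * (s - s₀)) * b u) ∈ localDegPS (Fp L) L (IsCMField.complexConj L) (complexConj_imagUnit L) (imagUnit_ne_zero L) (imagUnit_mul_self L)
          v n (gramR_isSymm L e dV hdV dW hdW) (hermD_eq_map_gramD L e dV hdV dW hdW) (fun w => χ.localComponent w.1) s :=
  ⟨heightTwistLoc_siegel L e dV hdV hdV0 dW hdW hdW0 v 𝒦 hb s, heightTwistLoc_smooth L e dV hdV hdV0 dW hdW hdW0 v h𝒦 hb.2 _⟩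

end Local

/-! ## §2 The archimedean height `H_∞(a) := |det_Δ p_{(a,1)}|^{1∕2}` and the arch flat family `H_∞^{2(s−s₀)}·A` -/

include hdV0 hdW0 in
/-- **left law**: `H_∞(p_∞ a) = |det_Δ p|^{1∕2} H_∞(a)` for `p ∈ P_Δ(𝔸)` with `p_f = 1`. [cite: Tan1999, §1] -/
theorem heightArch_siegel_mul (𝒦 : IwasawaDatum L e dV hdV dW hdW) {p : HA L e dV hdV dW hdW} (hp : IsSiegelDelta L e dV hdV dW hdW p) (hpf : UnitaryGroup.finPart (Fp L) L (IsCMField.complexConj L) (n + n) (hermD L e dV hdV dW hdW) p = 1) (a : UnitaryGroup.arch (Fp L) L (IsCMField.complexConj L) (n + n) (hermD L e dV hdV dW hdW)) :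
    modDelta L e dV hdV dW hdW (𝒦.pPart (UnitaryGroup.archToAdelic (Fp L) L (IsCMField.complexConj L) (n + n) (hermD L e dV hdV dW hdW) (UnitaryGroup.archPart (Fp L) L (IsCMField.complexConj L) (n + n) (hermD L e dV hdV dW hdW) p * a))) = modDelta L e dV hdV dW hdW p * modDelta L e dV hdV dW hdW (𝒦.pPart (UnitaryGroup.archToAdelic (Fp L) L (IsCMField.complexConj L) (n + n) (hermD L e dV hdV dW hdW) a)) := by
  have hp' : (UnitaryGroup.archToAdelic (Fp L) L (IsCMField.complexConj L) (n + n) (hermD L e dV hdV dW hdW) (UnitaryGroup.archPart (Fp L) L (IsCMField.complexConj L) (n + n) (hermD L e dV hdV dW hdW) p) : HA L e dV hdV dW hdW) = p := by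
    have h1 := UnitaryGroup.archToAdelic_mul_finAdelicToAdelic (Fp L) L (IsCMField.complexConj L) (n + n) (hermD L e dV hdV dW hdW) p
    rw [hpf, map_one, mul_one] at h1
    exact h1
  rw [map_mul, hp']
  exact IwasawaDatum.modDelta_pPart_delta_mul (IwasawaDatum.modDelta_eq_one_of_mem L e dV hdV hdV0 dW hdW hdW0 𝒦) hp _

include hdV0 hdW0 in
/-- **right invariance**: `H_∞(x a₀) = H_∞(x)` when `(a₀, 1) ∈ 𝒦.K`. [cite: Tan1999, §1] -/
theorem heightArch_mul_of_mem (𝒦 : IwasawaDatum L e dV hdV dW hdW) (x : UnitaryGroup.arch (Fp L) L (IsCMField.complexConj L) (n + n) (hermD L e dV hdV dW hdW)) {a₀ : UnitaryGroup.arch (Fp L) L (IsCMField.complexConj L) (n + n) (hermD L e dV hdV dW hdW)} (ha₀ : (UnitaryGroup.archToAdelic (Fp L) L (IsCMField.complexConj L) (n + n) (hermD L e dV hdV dW hdW) a₀ : HA L e dV hdV dW hdW) ∈ 𝒦.K) :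
    modDelta L e dV hdV dW hdW (𝒦.pPart (UnitaryGroup.archToAdelic (Fp L) L (IsCMField.complexConj L) (n + n) (hermD L e dV hdV dW hdW) (x * a₀))) = modDelta L e dV hdV dW hdW (𝒦.pPart (UnitaryGroup.archToAdelic (Fp L) L (IsCMField.complexConj L) (n + n) (hermD L e dV hdV dW hdW) x)) := by
  rw [map_mul]
  exact IwasawaDatum.modDelta_pPart_mul_K (IwasawaDatum.modDelta_eq_one_of_mem L e dV hdV hdV0 dW hdW hdW0 𝒦) _ ha₀

include hdV0 hdW0 in
/-- `H_∞` is continuous. [cite: BorelJacquet1979, §4.1] -/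
theorem continuous_heightArch (𝒦 : IwasawaDatum L e dV hdV dW hdW) : Continuous fun a : UnitaryGroup.arch (Fp L) L (IsCMField.complexConj L) (n + n) (hermD L e dV hdV dW hdW) => modDelta L e dV hdV dW hdW (𝒦.pPart (UnitaryGroup.archToAdelic (Fp L) L (IsCMField.complexConj L) (n + n) (hermD L e dV hdV dW hdW) a)) :=
  (continuous_iwasawaHeight L e dV hdV hdV0 dW hdW hdW0 𝒦).comp (UnitaryGroup.continuous_archToAdelic (Fp L) L (IsCMField.complexConj L) (n + n) (hermD L e dV hdV dW hdW))

include hdV0 hdW0 in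
/-- **the arch flat family keeps the archimedean Siegel law, AT `s`**. [cite: Tan1999, §1] [cite: KudlaRallis1994, §1] -/
theorem heightTwistArch_siegel (𝒦 : IwasawaDatum L e dV hdV dW hdW) {χ : HeckeCharacter L} {s₀ : ℂ} {A : UnitaryGroup.arch (Fp L) L (IsCMField.complexConj L) (n + n) (hermD L e dV hdV dW hdW) → ℂ}
    (hA : (∀ p : HA L e dV hdV dW hdW, IsSiegelDelta L e dV hdV dW hdW p → UnitaryGroup.finPart (Fp L) L (IsCMField.complexConj L) (n + n) (hermD L e dV hdV dW hdW) p = 1 →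
          ∀ x : UnitaryGroup.arch (Fp L) L (IsCMField.complexConj L) (n + n) (hermD L e dV hdV dW hdW), A (UnitaryGroup.archPart (Fp L) L (IsCMField.complexConj L) (n + n) (hermD L e dV hdV dW hdW) p * x) = siegelDeltaCharacter L e dV hdV dW hdW χ s₀ p * A x)) (s : ℂ) :
    (∀ p : HA L e dV hdV dW hdW, IsSiegelDelta L e dV hdV dW hdW p → UnitaryGroup.finPart (Fp L) L (IsCMField.complexConj L) (n + n) (hermD L e dV hdV dW hdW) p = 1 →
          ∀ x : UnitaryGroup.arch (Fp L) L (IsCMField.complexConj L) (n + n) (hermD L e dV hdV dW hdW), (fun a => ((modDelta L e dV hdV dW hdW (𝒦.pPart (UnitaryGroup.archToAdelic (Fp L) L (IsCMField.complexConj L) (n + n) (hermD L e dV hdV dW hdW) a)) : ℝ) : ℂ) ^ (2 * (s - s₀)) * A a) (UnitaryGroup.archPart (Fp L) L (IsCMField.complexConj L) (n + n) (hermD L e dV hdV dW hdW) p * x) = siegelDeltaCharacter L e dV hdV dW hdW χ s p * (fun a => ((modDelta L e dV hdV dW hdW (𝒦.pPart (UnitaryGroup.archToAdelic (Fp L) L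 (IsCMField.complexConj L) (n + n) (hermD L e dV hdV dW hdW) a)) : ℝ) : ℂ) ^ (2 * (s - s₀)) * A a) x) := by
  intro p hp hpf x
  show ((modDelta L e dV hdV dW hdW (𝒦.pPart (UnitaryGroup.archToAdelic (Fp L) L (IsCMField.complexConj L) (n + n) (hermD L e dV hdV dW hdW) (UnitaryGroup.archPart (Fp L) L (IsCMField.complexConj L) (n + n) (hermD L e dV hdV dW hdW) p * x))) : ℝ) : ℂ) ^ (2 * (s - s₀)) * A (UnitaryGroup.archPart (Fp L) L (IsCMField.complexConj L) (n + n) (hermD L e dV hdV dW hdW) p * x) = siegelDeltaCharacter L e dV hdV dW hdW χ s p * (((modDelta L e dV hdV dW hdW (𝒦.pPart (UnitaryGroup.archToAdelic (Fp L) L (IsCMField.complexConj L) (n + n) (hermD L e dV hdV dW hdW) x)) : ℝ) : ℂ) ^ (2 * (s - s₀)) * A x)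
  rw [hA p hp hpf x, heightArch_siegel_mul L e dV hdV hdV0 dW hdW hdW0 𝒦 hp hpf x, Complex.ofReal_mul,
    Complex.mul_cpow_ofReal_nonneg (modDelta_pos L e dV hdV dW hdW _).le (modDelta_pos L e dV hdV dW hdW _).le, ← modDelta_cpow_mul_siegelDeltaCharacter e dV hdV dW hdW χ s₀ s p]
  ring

include hdV0 hdW0 in
/-- **the arch flat family is `K_∞`-finite** (the finite-dimensional stable space `H_∞^{2(s−s₀)}·V`, right-invariance of `H_∞`). [cite: HarrisKudlaSweet1996, §1 (1.17)] -/
theorem heightTwistArch_kfinite (𝒦 : IwasawaDatum L e dV hdV dW hdW) {s₀ : ℂ} {A : UnitaryGroup.arch (Fp L) L (IsCMField.complexConj L) (n + n) (hermD L e dV hdV dW hdW) → ℂ} (hfin : (∃ V : Submodule ℂ (UnitaryGroup.arch (Fp L) L (IsCMField.complexConj L) (n + n) (hermD L e dV hdV dW hdW) → ℂ), FiniteDimensional ℂ V ∧ A ∈ V ∧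
          ∀ a₀ : UnitaryGroup.arch (Fp L) L (IsCMField.complexConj L) (n + n) (hermD L e dV hdV dW hdW), (UnitaryGroup.archToAdelic (Fp L) L (IsCMField.complexConj L) (n + n) (hermD L e dV hdV dW hdW) a₀ : HA L e dV hdV dW hdW) ∈ 𝒦.K → ∀ G ∈ V, (fun x => G (x * a₀)) ∈ V)) (s : ℂ) :
    (∃ V : Submodule ℂ (UnitaryGroup.arch (Fp L) L (IsCMField.complexConj L) (n + n) (hermD L e dV hdV dW hdW) → ℂ), FiniteDimensional ℂ V ∧ (fun a => ((modDelta L e dV hdV dW hdW (𝒦.pPart (UnitaryGroup.archToAdelic (Fp L) L (IsCMField.complexConj L) (n + n) (hermD L e dV hdV dW hdW) a)) : ℝ) : ℂ) ^ (2 * (s - s₀)) * A a) ∈ V ∧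
          ∀ a₀ : UnitaryGroup.arch (Fp L) L (IsCMField.complexConj L) (n + n) (hermD L e dV hdV dW hdW), (UnitaryGroup.archToAdelic (Fp L) L (IsCMField.complexConj L) (n + n) (hermD L e dV hdV dW hdW) a₀ : HA L e dV hdV dW hdW) ∈ 𝒦.K → ∀ G ∈ V, (fun x => G (x * a₀)) ∈ V) := by
  obtain ⟨V, hVfd, hAV, hstab⟩ := hfin
  haveI := hVfd
  -- multiplication by the (fixed) function `H_∞^{2(s−s₀)}` as a linear map
  refine ⟨V.map (LinearMap.mul ℂ (UnitaryGroup.arch (Fp L) L (IsCMField.complexConj L) (n + n) (hermD L e dV hdV dW hdW) → ℂ) (fun a => ((modDelta L e dV hdV dW hdW (𝒦.pPart (UnitaryGroup.archToAdelic (Fp L) L (IsCMField.complexConj L) (n + n) (hermD L e dV hdV dW hdW) a)) : ℝ) : ℂ) ^ (2 * (s - s₀)))), inferInstance, ⟨A, hAV, rfl⟩, fun a₀ ha₀ G hG => ?_⟩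
  obtain ⟨G', hG', rfl⟩ := hG
  refine ⟨fun x => G' (x * a₀), hstab a₀ ha₀ G' hG', funext fun x => ?_⟩
  simp only [LinearMap.mul_apply', Pi.mul_apply, heightArch_mul_of_mem L e dV hdV hdV0 dW hdW hdW0 𝒦 x ha₀]

include hdV0 hdW0 in
/-- **the arch flat family is continuous** when `A` is. [cite: BorelJacquet1979, §4.1] -/
theorem continuous_heightTwistArch (𝒦 : IwasawaDatum L e dV hdV dW hdW) (s₀ s : ℂ) {A : UnitaryGroup.arch (Fp L) L (IsCMField.complexConj L) (n + n) (hermD L e dV hdV dW hdW) → ℂ} (hA : Continuous A) :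
    Continuous fun a : UnitaryGroup.arch (Fp L) L (IsCMField.complexConj L) (n + n) (hermD L e dV hdV dW hdW) => ((modDelta L e dV hdV dW hdW (𝒦.pPart (UnitaryGroup.archToAdelic (Fp L) L (IsCMField.complexConj L) (n + n) (hermD L e dV hdV dW hdW) a)) : ℝ) : ℂ) ^ (2 * (s - s₀)) * A a :=
  (((Complex.continuous_ofReal.comp (continuous_heightArch L e dV hdV hdV0 dW hdW hdW0 𝒦)).cpow continuous_const
    fun _ => Complex.ofReal_mem_slitPlane.2 (modDelta_pos L e dV hdV dW hdW _))).mul hA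

/-! ## §3 (E6′) Away purity as a flat family on the slice -/

set_option maxHeartbeats 800000 in -- the adelic telescope under `Finset.sum`∕`finprod` (measured: fails at the default 200000, passes at 800000)
variable (T : Finset (HeightOneSpectrum (𝓞 (Fp L)))) [DecidableEq (HeightOneSpectrum (𝓞 (Fp L)))] in
include hdV0 hdW0 in
/-- the slice identity for ONE `T` (given the level∕unramified guards and ★ (asm-3AB)'s identity at `s₀`). [cite: Tan1999, §1] [cite: Liu2011, §2B p. 862] -/
theorem apply_placesEmbed_eq_sum_of_awayPurity {𝒦 : IwasawaDatum L e dV hdV dW hdW} (h𝒦 : 𝒦.IsStd) {χ : HeckeCharacter L} {f : ℂ → HA L e dV hdV dW hdW → ℂ}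
    (hf : IsStandardSectionFamily 𝒦 χ f) (s₀ : ℂ)
    (hKT : ∀ k ∈ 𝒦.K, ∀ v, v ∉ T → UnitaryGroup.evalPlace (Fp L) L (IsCMField.complexConj L) (n + n) (hermD L e dV hdV dW hdW) v (UnitaryGroup.finPart (Fp L) L (IsCMField.complexConj L) (n + n) (hermD L e dV hdV dW hdW) k) ∈ UnitaryGroup.localInt L (IsCMField.complexConj L) (n + n) (hermD L e dV hdV dW hdW) v)
    (hχT : ∀ v, v ∉ T → ∀ w : UnitaryGroup.PlacesOver L v, χ.IsUnramifiedAt w.1)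
    {m : ℕ} (b : Fin m → (v : HeightOneSpectrum (𝓞 (Fp L))) → (UnitaryGroup.localPi L (IsCMField.complexConj L) (n + n) (hermD L e dV hdV dW hdW) v → ℂ)) (A : Fin m → UnitaryGroup.arch (Fp L) L (IsCMField.complexConj L) (n + n) (hermD L e dV hdV dW hdW) → ℂ)
    (hsum : ∀ h : HA L e dV hdV dW hdW, f s₀ h =
      (∑ i, A i (UnitaryGroup.archPart (Fp L) L (IsCMField.complexConj L) (n + n) (hermD L e dV hdV dW hdW) h) * ∏ v ∈ T, b i v (UnitaryGroup.evalPlace (Fp L) L (IsCMField.complexConj L) (n + n) (hermD L e dV hdV dW hdW) v (UnitaryGroup.finPart (Fp L) L (IsCMField.complexConj L) (n + n) (hermD L e dV hdV dW hdW) h))) *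
        ∏ᶠ v : {v : HeightOneSpectrum (𝓞 (Fp L)) // v ∉ T}, LambdaLoc L e dV hdV dW hdW v.1 χ s₀ (UnitaryGroup.evalPlace (Fp L) L (IsCMField.complexConj L) (n + n) (hermD L e dV hdV dW hdW) v.1 (UnitaryGroup.finPart (Fp L) L (IsCMField.complexConj L) (n + n) (hermD L e dV hdV dW hdW) h)))
    (s : ℂ) (yi : UnitaryGroup.arch (Fp L) L (IsCMField.complexConj L) (n + n) (hermD L e dV hdV dW hdW)) (y : Π v : T, UnitaryGroup.localPi L (IsCMField.complexConj L) (n + n) (hermD L e dV hdV dW hdW) v.1) :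
    f s (placesEmbed L (hermD L e dV hdV dW hdW) T (yi, y)) =
      ∑ i, (((modDelta L e dV hdV dW hdW (𝒦.pPart (UnitaryGroup.archToAdelic (Fp L) L (IsCMField.complexConj L) (n + n) (hermD L e dV hdV dW hdW) yi)) : ℝ) : ℂ) ^ (2 * (s - s₀)) * A i yi) * ∏ v : T, (((modDelta L e dV hdV dW hdW (𝒦.pPart (locToAdelic L e dV hdV dW hdW v.1 (y v))) : ℝ) : ℂ) ^ (2 * (s - s₀)) * b i v.1 (y v)) := by
  have hflat := (stdExtension_apply_eq_of_flat (𝒦 := 𝒦) hf.1.1 hf.2.2 s₀ s (placesEmbed L (hermD L e dV hdV dW hdW) T (yi, y))).symm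
  rw [hflat, stdExtension, hsum, modDelta_pPart_placesEmbed L e dV hdV hdV0 dW hdW hdW0 T h𝒦 hKT yi y, archPart_placesEmbed]
  have hΛ : ∏ᶠ v : {v : HeightOneSpectrum (𝓞 (Fp L)) // v ∉ T}, LambdaLoc L e dV hdV dW hdW v.1 χ s₀ (UnitaryGroup.evalPlace (Fp L) L (IsCMField.complexConj L) (n + n) (hermD L e dV hdV dW hdW) v.1 (UnitaryGroup.finPart (Fp L) L (IsCMField.complexConj L) (n + n) (hermD L e dV hdV dW hdW) (placesEmbed L (hermD L e dV hdV dW hdW) T (yi, y)))) = 1 :=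
    finprod_eq_one_of_forall_eq_one fun v => by
      rw [evalPlace_finPart_placesEmbed_of_not_mem L e dV hdV dW hdW T yi y v.1 v.2, lambdaLoc_one L e dV hdV dW hdW v.1 χ s₀ (hχT v.1 v.2)]
  have hprod : ∀ i, ∏ v ∈ T, b i v (UnitaryGroup.evalPlace (Fp L) L (IsCMField.complexConj L) (n + n) (hermD L e dV hdV dW hdW) v (UnitaryGroup.finPart (Fp L) L (IsCMField.complexConj L) (n + n) (hermD L e dV hdV dW hdW) (placesEmbed L (hermD L e dV hdV dW hdW) T (yi, y)))) = ∏ v : T, b i v.1 (y v) := fun i => by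
    rw [← Finset.prod_coe_sort T (fun v => b i v (UnitaryGroup.evalPlace (Fp L) L (IsCMField.complexConj L) (n + n) (hermD L e dV hdV dW hdW) v (UnitaryGroup.finPart (Fp L) L (IsCMField.complexConj L) (n + n) (hermD L e dV hdV dW hdW) (placesEmbed L (hermD L e dV hdV dW hdW) T (yi, y)))))]
    exact Finset.prod_congr rfl fun v _ => by rw [evalPlace_finPart_placesEmbed_of_mem L e dV hdV dW hdW T yi y v.1 v.2]
  rw [hΛ, mul_one, Finset.sum_congr rfl fun i _ => by rw [hprod i], Complex.ofReal_mul,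
    Complex.mul_cpow_ofReal_nonneg (modDelta_pos L e dV hdV dW hdW _).le (Finset.prod_nonneg fun v _ => (modDelta_pos L e dV hdV dW hdW _).le),
    ofReal_prod_cpow _ _ (fun v _ => (modDelta_pos L e dV hdV dW hdW _).le), Finset.mul_sum]
  refine Finset.sum_congr rfl fun i _ => ?_
  rw [Finset.prod_mul_distrib]
  ring

set_option maxHeartbeats 800000 in -- as above (measured)
include hdV0 hdW0 in
/-- **(E6′) AWAY PURITY AS A FLAT FAMILY ON THE SLICE.**  For `𝒦` standard, `f` a `𝒦`-standard continuous family for `χ`, and any `s₀`: there is `S₀` such that for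
every `T ⊇ S₀` — `(𝒦.K)_v ⊆ K_{H,v}` off `T`, `χ` unramified off `T` — ★ (asm-3AB)'s data `(m, b, A)` at `s₀` (all five letters: `b_{i,v} ∈ I_v(s₀,χ_v)` on `T`,
`A_i` `K_∞`-finite, continuous, archimedean Siegel law, the identity at `s₀`) satisfies, for EVERY `s`, the slice identity
`f_s(placesEmbed_T(y_∞,y)) = Σ_i (H_∞(y_∞)^{2(s−s₀)} A_i y_∞) ∏_{v∈T} (H_v(y_v)^{2(s−s₀)} b_{i,v}(y_v))`.  The per-factor letters at `s` are §1–§2.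
[cite: Tan1999, §1 p. 166] [cite: KudlaRallis1994, §1] [cite: HarrisKudlaSweet1996, §1 (1.15)–(1.17)] [cite: Liu2011, §2B p. 862] [cite: BorelJacquet1979, §4.1] -/
theorem exists_awayPurity_flat [DecidableEq (HeightOneSpectrum (𝓞 (Fp L)))] {𝒦 : IwasawaDatum L e dV hdV dW hdW} (h𝒦 : 𝒦.IsStd) {χ : HeckeCharacter L}
    {f : ℂ → HA L e dV hdV dW hdW → ℂ} (hf : IsStandardSectionFamily 𝒦 χ f) (hfc : ∀ s, Continuous (f s)) (s₀ : ℂ) :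
    ∃ S₀ : Finset (HeightOneSpectrum (𝓞 (Fp L))), ∀ T : Finset (HeightOneSpectrum (𝓞 (Fp L))), S₀ ⊆ T →
      (∀ k ∈ 𝒦.K, ∀ v, v ∉ T → UnitaryGroup.evalPlace (Fp L) L (IsCMField.complexConj L) (n + n) (hermD L e dV hdV dW hdW) v (UnitaryGroup.finPart (Fp L) L (IsCMField.complexConj L) (n + n) (hermD L e dV hdV dW hdW) k) ∈ UnitaryGroup.localInt L (IsCMField.complexConj L) (n + n) (hermD L e dV hdV dW hdW) v) ∧
      (∀ v, v ∉ T → ∀ w : UnitaryGroup.PlacesOver L v, χ.IsUnramifiedAt w.1) ∧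
      ∃ (m : ℕ) (b : Fin m → (v : HeightOneSpectrum (𝓞 (Fp L))) → (UnitaryGroup.localPi L (IsCMField.complexConj L) (n + n) (hermD L e dV hdV dW hdW) v → ℂ)) (A : Fin m → UnitaryGroup.arch (Fp L) L (IsCMField.complexConj L) (n + n) (hermD L e dV hdV dW hdW) → ℂ),
        (∀ i, ∀ v ∈ T, b i v ∈ localDegPS (Fp L) L (IsCMField.complexConj L) (complexConj_imagUnit L) (imagUnit_ne_zero L) (imagUnit_mul_self L)
          v n (gramR_isSymm L e dV hdV dW hdW) (hermD_eq_map_gramD L e dV hdV dW hdW) (fun w => χ.localComponent w.1) s₀) ∧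
        (∀ i, (∃ V : Submodule ℂ (UnitaryGroup.arch (Fp L) L (IsCMField.complexConj L) (n + n) (hermD L e dV hdV dW hdW) → ℂ), FiniteDimensional ℂ V ∧ A i ∈ V ∧
          ∀ a₀ : UnitaryGroup.arch (Fp L) L (IsCMField.complexConj L) (n + n) (hermD L e dV hdV dW hdW), (UnitaryGroup.archToAdelic (Fp L) L (IsCMField.complexConj L) (n + n) (hermD L e dV hdV dW hdW) a₀ : HA L e dV hdV dW hdW) ∈ 𝒦.K → ∀ G ∈ V, (fun x => G (x * a₀)) ∈ V)) ∧
        (∀ i, Continuous (A i)) ∧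
        (∀ i, (∀ p : HA L e dV hdV dW hdW, IsSiegelDelta L e dV hdV dW hdW p → UnitaryGroup.finPart (Fp L) L (IsCMField.complexConj L) (n + n) (hermD L e dV hdV dW hdW) p = 1 →
          ∀ x : UnitaryGroup.arch (Fp L) L (IsCMField.complexConj L) (n + n) (hermD L e dV hdV dW hdW), A i (UnitaryGroup.archPart (Fp L) L (IsCMField.complexConj L) (n + n) (hermD L e dV hdV dW hdW) p * x) = siegelDeltaCharacter L e dV hdV dW hdW χ s₀ p * A i x)) ∧
        (∀ h : HA L e dV hdV dW hdW, f s₀ h =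
          (∑ i, A i (UnitaryGroup.archPart (Fp L) L (IsCMField.complexConj L) (n + n) (hermD L e dV hdV dW hdW) h) * ∏ v ∈ T, b i v (UnitaryGroup.evalPlace (Fp L) L (IsCMField.complexConj L) (n + n) (hermD L e dV hdV dW hdW) v (UnitaryGroup.finPart (Fp L) L (IsCMField.complexConj L) (n + n) (hermD L e dV hdV dW hdW) h))) *
            ∏ᶠ v : {v : HeightOneSpectrum (𝓞 (Fp L)) // v ∉ T}, LambdaLoc L e dV hdV dW hdW v.1 χ s₀ (UnitaryGroup.evalPlace (Fp L) L (IsCMField.complexConj L) (n + n) (hermD L e dV hdV dW hdW) v.1 (UnitaryGroup.finPart (Fp L) L (IsCMField.complexConj L) (n + n) (hermD L e dV hdV dW hdW) h))) ∧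
        ∀ (s : ℂ) (yi : UnitaryGroup.arch (Fp L) L (IsCMField.complexConj L) (n + n) (hermD L e dV hdV dW hdW)) (y : Π v : T, UnitaryGroup.localPi L (IsCMField.complexConj L) (n + n) (hermD L e dV hdV dW hdW) v.1),
          f s (placesEmbed L (hermD L e dV hdV dW hdW) T (yi, y)) =
            ∑ i, (((modDelta L e dV hdV dW hdW (𝒦.pPart (UnitaryGroup.archToAdelic (Fp L) L (IsCMField.complexConj L) (n + n) (hermD L e dV hdV dW hdW) yi)) : ℝ) : ℂ) ^ (2 * (s - s₀)) * A i yi) * ∏ v : T, (((modDelta L e dV hdV dW hdW (𝒦.pPart (locToAdelic L e dV hdV dW hdW v.1 (y v))) : ℝ) : ℂ) ^ (2 * (s - s₀)) * b i v.1 (y v)) := by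
  obtain ⟨S₁, hS₁⟩ := exists_awayPurity_continuous L e dV hdV hdV0 dW hdW hdW0 h𝒦 hf hfc s₀
  obtain ⟨T₁, hT₁⟩ := exists_finset_forall_evalPlace_finPart_mem_localInt L e dV hdV dW hdW h𝒦
  obtain ⟨T₂, hT₂⟩ : ∃ T₂ : Finset (HeightOneSpectrum (𝓞 (Fp L))), ∀ v ∉ T₂, ∀ w : UnitaryGroup.PlacesOver L v, χ.IsUnramifiedAt w.1 :=
    ⟨(Filter.eventually_cofinite.1 (UnitaryGroup.eventually_forall_placesOver (F := Fp L) L (Q := fun w => χ.IsUnramifiedAt w)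
        (HeckeCharacter.isUnramifiedAt_cofinite_holds χ))).toFinset,
      fun v hv => by
        by_contra h1
        exact hv ((Set.Finite.mem_toFinset _).2 h1)⟩
  refine ⟨S₁ ∪ T₁ ∪ T₂, fun T hT => ?_⟩
  have hKT : ∀ k ∈ 𝒦.K, ∀ v, v ∉ T → UnitaryGroup.evalPlace (Fp L) L (IsCMField.complexConj L) (n + n) (hermD L e dV hdV dW hdW) v (UnitaryGroup.finPart (Fp L) L (IsCMField.complexConj L) (n + n) (hermD L e dV hdV dW hdW) k) ∈ UnitaryGroup.localInt L (IsCMField.complexConj L) (n + n) (hermD L e dV hdV dW hdW) v :=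
    fun k hk v hv => hT₁ k hk v fun h => hv (hT (Finset.mem_union_left _ (Finset.mem_union_right _ h)))
  have hχT : ∀ v, v ∉ T → ∀ w : UnitaryGroup.PlacesOver L v, χ.IsUnramifiedAt w.1 :=
    fun v hv => hT₂ v fun h => hv (hT (Finset.mem_union_right _ h))
  obtain ⟨m, b, A, hb, hfin, hcont, hsieg, hsum⟩ := hS₁ T ((Finset.subset_union_left.trans Finset.subset_union_left).trans hT)
  exact ⟨hKT, hχT, m, b, A, hb, hfin, hcont, hsieg, hsum, fun s yi y =>
    apply_placesEmbed_eq_sum_of_awayPurity L e dV hdV hdV0 dW hdW hdW0 T h𝒦 hf s₀ hKT hχT b A hsum s yi y⟩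

end Summit.HodgeConjecture.HodgeConjecture.Cruxes.HLiu418.K2LiuStdFamilyAwayPurityFlat

end
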